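import Summits.QuantumFields.BalabanUV.T4Continuum.Support.NE3CpushGaugeCovariance
import Summits.QuantumFields.BalabanUV.T4Continuum.Support.NE3SmoothRightInverseBounds
import Summits.QuantumFields.BalabanUV.T4Continuum.Support.BlockAverageCurrent
import Summits.QuantumFields.BalabanUV.T4Continuum.Support.NE3CovariantTentInterpolant
import HarnessLib

/-!
# T⁴ programme, node NE3 — route Π, row Π-R (curved step), file Π-R-W2: THE DRESSED SMOOTH LIFT, THE COVARIANT CORRECTOR, AND THE EXACT IDENTITY
# `D_W R̂_W φ = (QbarIter L (j+1) W₀ (smoothLift M φ))^{u⁻¹ ∘ M•}` (`W₀ = W^u` the block comb gauge at scale `M = L^{j+1}`)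

NE3 (node U1b) formalisation swarm, leaf seat `b2b-balaban-t4-ne3-formalise-leaf-01` (gen 7); design note D-ne3leaf01g7-2 (`HOME/CLAIMS.log` l.22114), memo
`HOME/b2b-balaban-t4-ne3-formalise-leaf-01/g7/PI-RW-DESIGN-leaf01g7.md` §1–§2, file W2.  OBJECTS: the block COMB GAUGE of the fine background at scale `M` as
ONE site field `u = combGauge M W` (`u(x) = W(Γ_{M·blk x, x})`, this lineage's `NE3CombGauge`∕the tree's `btree`), the comb-gauged background `W₀ = combCfg M W
= W^u` (unit on every comb, in-block plaquette-small, inter-corner holonomies on the face-crossing bonds), the DRESSED LIFT `smoothLiftW = (smoothLift M φ)^{u⁻¹}`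
(Π-R♭-2's flat lift read in the comb gauge and dressed back; `Ad` is an isometry, so every size letter of Π-R♭-4 holds verbatim), and the COVARIANT CORRECTOR
`correctorW = gaugeDir W (−Ad_{u⁻¹} Λ₀)`, `Λ₀ = interp M univ (framePotW L (j+1) W₀ (smoothLift M φ))` (H3's multilinear interpolant of leaf-04's accumulated frame
generator AT `W₀`).  THE IDENTITY (memo §2 (1)+(2)): by W1's finite gauge covariance (`dirIter_gaugeAct`, `gaugeDir_gaugeAct`) the computation moves to `W₀`, where
leaf-04's structure theorem `dirIter = QbarIter + gaugeDir∘framePotW`, `dirIter_gaugeDir` and H3's `interp_corner` kill the frame part EXACTLY — as Π-R♭-3 did at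
`W = 1`: **`dirIter L (j+1) W (R̂_W φ) = (QbarIter L (j+1) W₀ (smoothLift M φ))^{u⁻¹∘M•}`**.  What is LEFT for exactness is the straight part
`QbarIter L (j+1) W₀ (smoothLift M φ) ≈ φ` (W4, the crux) and the near-identity solve (W5).  At `W = 1`: `u = 1`, `W₀ = 1`, `R̂_1 = smoothRightInverse L j`
(`smoothRightInverseHatW_flat`).

CONTENT ([folklore]; 0 sorry; DATA defs `dressDir`, `combGauge`, `combCfg`, `smoothLiftW`, `frameGenW`, `correctorW`, `smoothRightInverseHatW` → definition lane):
§1 gauge bookkeeping (`gaugeAct_inv_gaugeAct`, `dressDir_add`, `isSkewDir_dressDir`, `tower_eq_pow_mul`); §2 the comb gauge as a site field (unitary,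
periodic, `= 1` at `W = 1`) and `combCfg` (unitary, small-field, periodic); §3 `framePotW_skew`, `framePotW_add_period` (leaf-04's one-level lemmas iterated);
§4 the data, skewness∕periodicity, the flat reductions **`smoothRightInverseHatW_flat`**; §5 **`dirIter_smoothRightInverseHatW`**.

HONEST FRAMING.  Kinematics of OUR objects at one background in the multi-level small-field class; the curved right inverse is NOT yet exact (W4∕W5 open); nothing about
minimisers; (P♮)_W, T-E_w and **NE3 are NOT proved**; spine PROVED 0∕9; finite T⁴ rung (B)+1 — NOT infinite volume, NOT mass gap, NOT `BetaPertH`, NOT Clay.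
PLACEMENT: `Summits/QuantumFields/BalabanUV/`.  HONEST DEPENDENCY (cell page 1): continuum YM on T⁴ ⇐ BetaPertH ∧ nine spine estimates (0/9 proved); BetaPertH ⇐
(D1) ∧ (D4) ∧ CAP+tail; G-an2-4 gates asym, D1 and NE2/3/4.
-/

set_option autoImplicit false

open scoped BigOperators Matrix.Norms.L2Operator
open Finset

namespace Summit.QuantumFields.BalabanUV.T4Continuum.NE3SmoothLiftW

open Literature.MathematicalPhysics.QuantumFieldTheory.Balaban1983to89
open B7Prop1Explicit B7Prop2Explicit
open T4AveragingDeficitWall (IsUnitaryCfg IsSkewDir SmallField Ad)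
open T4AveragingDeficitWallBoundary (IsPeriodicCfg)
open AveragingDeficitPeriodicCounting (IsPeriodicDir)
open AveragingDeficitTransport (Ad_mem_skewAdjoint)
open AveragingDeficitNearIdentity (Ad_add Ad_one Ad_zero Ad_neg)
open AveragingDeficitChartCalculus (cavg)
open AveragingDeficitMultiLevelPrep (cavgIter LevelSmall tower natCast_tower_succ tower_ne_zero)
open AveragingDeficitFermat (isPeriodicCfg_cavg)
open AveragingDeficitBlockDensity (btree btree_mem btree_add_period)
open BlockAverageCurrent (smallField_gaugeAct)
open BlockAveragePushDirGauge (gaugeDir)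
open BlockAveragePushDirSplit (flat)
open SmoothRefineBlocks (blk blk_res_add_period blk_res_smul)
open SmoothRefineInterp (interp interp_mem)
open NE3TangentNoGoWords (dPot)
open NE3TangentFlatStructure (framePot)
open NE3TangentCovariantStructure (Qbar Fbar Qbar_skew Fbar_skew Qbar_add_period Fbar_add_period gaugeDir_add_fun)
open NE3TangentCovariantTower (dirIter QbarIter framePotW framePotW_succ step_small dirIter_add dirIter_gaugeDir dirIter_eq_QbarIter_add_gaugeDir
  cavgIter_flat QbarIter_flat framePotW_flat gaugeDir_flat)
open NE3CoarseInterpolant (interp_corner interp_add_period)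
open NE3SmoothLiftFlat (smoothLift)
open NE3SmoothRightInverseFlat (smoothRightInverse)
open NE3SmoothRightInverseBounds (smoothLift_add_period)
open NE3CpushGaugeCovariance (gaugeDir_gaugeAct dirIter_gaugeAct)
open NE3CovariantTentInterpolant (hol_flat)
open SpreadLiftDirection (isUnitaryCfg_gaugeAct')

noncomputable section

variable {d : ℕ} {n : Type*} [Fintype n] [DecidableEq n]

/-! ## §1 Gauge bookkeeping -/

/-- THE DRESSING of a direction by a gauge function: `ψ^u(x,μ) = Ad_{u(x+e_μ)} ψ(x,μ)` (the velocity of `(W·e^{sψ})^u`, W1 `vary_gaugeAct`). [folklore] -/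
def dressDir (u : Site d → (Matrix n n ℂ)ˣ) (ψ : Site d → Fin d → (Matrix n n ℂ)) : Site d → Fin d → (Matrix n n ℂ) := fun x μ => Ad (u (x + e μ)) (ψ x μ)

/-- Undoing a gauge transformation: `(W^u)^{u⁻¹} = W`. [folklore] -/
theorem gaugeAct_inv_gaugeAct (u : Site d → (Matrix n n ℂ)ˣ) (W : Site d → Fin d → (Matrix n n ℂ)ˣ) :
    gaugeAct (fun x => (u x)⁻¹) (gaugeAct u W) = W := by
  funext x μ
  simp only [gaugeAct, inv_inv, ← mul_assoc, inv_mul_cancel, one_mul, inv_mul_cancel_right]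

/-- Dressing is additive. [folklore] -/
theorem dressDir_add (u : Site d → (Matrix n n ℂ)ˣ) (A B : Site d → Fin d → (Matrix n n ℂ)) :
    dressDir u (fun x μ => A x μ + B x μ) = fun x μ => dressDir u A x μ + dressDir u B x μ := by
  funext x μ; simp only [dressDir, Ad_add]

/-- Dressing by a unitary gauge function preserves skewness. [folklore] -/
theorem isSkewDir_dressDir {u : Site d → (Matrix n n ℂ)ˣ} (hu : ∀ x, u x ∈ unitaryUnits (Matrix n n ℂ)) {ψ : Site d → Fin d → (Matrix n n ℂ)} (hψ : IsSkewDir ψ) :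
    IsSkewDir (dressDir u ψ) := fun x μ => Ad_mem_skewAdjoint (hu _) (hψ x μ)

/-- Dressing by `1` is the identity. [folklore] -/
theorem dressDir_one (ψ : Site d → Fin d → (Matrix n n ℂ)) : dressDir (fun _ => (1 : (Matrix n n ℂ)ˣ)) ψ = ψ := by
  funext x μ; simp only [dressDir, Ad_one]

/-- `tower L N k = L^k · N`. [folklore] -/
theorem tower_eq_pow_mul (L N : ℕ) : ∀ k : ℕ, tower L N k = L ^ k * N
  | 0 => by simp [tower]
  | k + 1 => by rw [show tower L N (k + 1) = L * tower L N k from rfl, tower_eq_pow_mul L N k, pow_succ]; ring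

/-- A gauge transform of a periodic configuration by a periodic gauge function is periodic. [folklore] -/
theorem isPeriodicCfg_gaugeAct {u : Site d → (Matrix n n ℂ)ˣ} {W : Site d → Fin d → (Matrix n n ℂ)ˣ} {P : ℤ} (hu : ∀ (x : Site d) (i : Fin d), u (x + P • e i) = u x)
    (hW : IsPeriodicCfg W P) : IsPeriodicCfg (gaugeAct u W) P := by
  intro x i μ
  simp only [gaugeAct, add_right_comm x (P • e i) (e μ), hu, hW x i μ]

/-! ## §2 The block comb gauge at scale `M` as one site field, and the comb-gauged background -/

/-- **THE BLOCK COMB GAUGE** at scale `M`: `u(x) = W(Γ_{M·blk x, x})` (the tree's `btree M W (blk M x) x`). [folklore] -/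
def combGauge (M : ℕ) (W : Site d → Fin d → (Matrix n n ℂ)ˣ) : Site d → (Matrix n n ℂ)ˣ := fun x => btree M W (blk M x) x

/-- **THE COMB-GAUGED BACKGROUND** `W₀ := W^u`. [folklore] -/
def combCfg (M : ℕ) (W : Site d → Fin d → (Matrix n n ℂ)ˣ) : Site d → Fin d → (Matrix n n ℂ)ˣ := gaugeAct (combGauge M W) W

/-- The comb gauge is unitary. [folklore] -/
theorem combGauge_mem {W : Site d → Fin d → (Matrix n n ℂ)ˣ} (hWu : IsUnitaryCfg W) (M : ℕ) (x : Site d) : combGauge M W x ∈ unitaryUnits (Matrix n n ℂ) :=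
  btree_mem hWu M _ _

/-- … and so is its pointwise inverse. [folklore] -/
theorem combGauge_inv_mem {W : Site d → Fin d → (Matrix n n ℂ)ˣ} (hWu : IsUnitaryCfg W) (M : ℕ) (x : Site d) : (combGauge M W x)⁻¹ ∈ unitaryUnits (Matrix n n ℂ) :=
  (unitaryUnits (Matrix n n ℂ)).inv_mem (combGauge_mem hWu M x)

/-- The comb gauge of an `(M·N)`-periodic background is `(M·N)`-periodic (`M ≥ 1`). [folklore] -/
theorem combGauge_add_period {M : ℕ} (hM : 1 ≤ M) {N : ℕ} {W : Site d → Fin d → (Matrix n n ℂ)ˣ} (hWP : IsPeriodicCfg W ((M : ℤ) * N)) (x : Site d) (i : Fin d) :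
    combGauge M W (x + ((M : ℤ) * N) • e i) = combGauge M W x := by
  obtain ⟨hb, -⟩ := blk_res_add_period (d := d) hM x (N : ℤ) i
  simp only [combGauge, hb]
  exact btree_add_period M hWP (blk M x) x i

/-- **THE COMB GAUGE IS `1` AT THE BLOCK CORNERS** (= the coarse sites `M•z`): `u(M•z) = W(Γ_{Mz,Mz}) = 1` (`M ≥ 1`). [folklore] -/
theorem combGauge_corner {M : ℕ} (hM : 1 ≤ M) (W : Site d → Fin d → (Matrix n n ℂ)ˣ) (z : Site d) : combGauge M W ((M : ℤ) • z) = 1 := by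
  obtain ⟨hb, -⟩ := blk_res_smul (d := d) hM z
  simp only [combGauge, hb, btree, sub_self, treeWord_zero, hol_nil]

/-- At `W = 1` the comb gauge is `1`. [folklore] -/
theorem combGauge_flat (M : ℕ) : combGauge M (flat (d := d) (n := n)) = fun _ => 1 := by
  funext x
  exact hol_flat _ _

/-- `combCfg` is unitary. [folklore] -/
theorem isUnitaryCfg_combCfg {W : Site d → Fin d → (Matrix n n ℂ)ˣ} (hWu : IsUnitaryCfg W) (M : ℕ) : IsUnitaryCfg (combCfg M W) :=
  isUnitaryCfg_gaugeAct' (combGauge_mem hWu M) hWu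

/-- `combCfg` is in the same small-field class. [folklore] -/
theorem smallField_combCfg [Nonempty n] {W : Site d → Fin d → (Matrix n n ℂ)ˣ} (hWu : IsUnitaryCfg W) {a : ℝ} (hWa : SmallField W a) (M : ℕ) :
    SmallField (combCfg M W) a :=
  smallField_gaugeAct (combGauge_mem hWu M) hWa

/-- `combCfg` of an `(M·N)`-periodic background is `(M·N)`-periodic. [folklore] -/
theorem isPeriodicCfg_combCfg {M : ℕ} (hM : 1 ≤ M) {N : ℕ} {W : Site d → Fin d → (Matrix n n ℂ)ˣ} (hWP : IsPeriodicCfg W ((M : ℤ) * N)) :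
    IsPeriodicCfg (combCfg M W) ((M : ℤ) * N) :=
  isPeriodicCfg_gaugeAct (combGauge_add_period hM hWP) hWP

/-- At `W = 1`, `combCfg = 1`. [folklore] -/
theorem combCfg_flat (M : ℕ) : combCfg M (flat (d := d) (n := n)) = flat := by
  funext x μ
  simp only [combCfg, combGauge_flat, gaugeAct, flat, inv_one, mul_one]

/-! ## §3 The accumulated frame generator is skew and periodic through the tower -/

/-- `framePotW L (j+1) W Y z ∈ 𝔲(N)` for skew `Y` at a unitary background in the multi-level small-field class. [folklore] -/
theorem framePotW_skew [Nonempty n] {L : ℕ} (hL : 1 ≤ L) :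
    ∀ (j : ℕ) {W : Site d → Fin d → (Matrix n n ℂ)ˣ} {x : ℝ}, IsUnitaryCfg W → 0 ≤ x → LevelSmall d L j x → SmallField W x →
    ∀ {Y : Site d → Fin d → (Matrix n n ℂ)}, IsSkewDir Y → ∀ z : Site d, framePotW L (j + 1) W Y z ∈ skewAdjoint (Matrix n n ℂ) := by
  intro j
  induction j with
  | zero =>
      intro W x hWu _ _ _ Y hY z
      rw [framePotW_succ]
      show framePotW L 0 (cavg L W) (Qbar L W Y) z + Fbar L W Y (((L : ℤ) ^ 0) • z) ∈ skewAdjoint (Matrix n n ℂ)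
      rw [NE3TangentCovariantTower.framePotW_zero, zero_add]
      exact Fbar_skew L hWu hY _
  | succ j ih =>
      intro W x hWu hx hs hWx Y hY z
      obtain ⟨h512, hW₁u, hr0, hW₁x⟩ := step_small hL hWu hx hs.1 hWx
      rw [framePotW_succ]
      exact (skewAdjoint (Matrix n n ℂ)).add_mem (ih hW₁u hr0 hs.2 hW₁x (Qbar_skew hL hWu hx h512 hWx hY) z) (Fbar_skew L hWu hY _)

/-- `framePotW L (j+1) W Y` is `N`-periodic when `W`, `Y` are `(L^{j+1}·N)`-periodic. [folklore] -/
theorem framePotW_add_period (L : ℕ) :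
    ∀ (j : ℕ) {W : Site d → Fin d → (Matrix n n ℂ)ˣ} {Y : Site d → Fin d → (Matrix n n ℂ)} {N : ℕ},
      IsPeriodicCfg W ((tower L N (j + 1) : ℕ) : ℤ) → IsPeriodicDir Y ((tower L N (j + 1) : ℕ) : ℤ) →
      ∀ (z : Site d) (i : Fin d), framePotW L (j + 1) W Y (z + (N : ℤ) • e i) = framePotW L (j + 1) W Y z := by
  intro j
  induction j with
  | zero =>
      intro W Y N hWP hYP z i
      rw [framePotW_succ]
      show framePotW L 0 (cavg L W) (Qbar L W Y) (z + (N : ℤ) • e i) + Fbar L W Y (((L : ℤ) ^ 0) • (z + (N : ℤ) • e i))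
        = framePotW L 0 (cavg L W) (Qbar L W Y) z + Fbar L W Y (((L : ℤ) ^ 0) • z)
      rw [NE3TangentCovariantTower.framePotW_zero, pow_zero, one_smul, one_smul]
      have hP : ((tower L N (0 + 1) : ℕ) : ℤ) = (L : ℤ) * (N : ℤ) := by rw [natCast_tower_succ]; rfl
      rw [hP] at hWP hYP
      rw [Fbar_add_period L hWP hYP z i]
  | succ j ih =>
      intro W Y N hWP hYP z i
      rw [framePotW_succ]
      show framePotW L (j + 1) (cavg L W) (Qbar L W Y) (z + (N : ℤ) • e i) + Fbar L W Y (((L : ℤ) ^ (j + 1)) • (z + (N : ℤ) • e i))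
        = framePotW L (j + 1) (cavg L W) (Qbar L W Y) z + Fbar L W Y (((L : ℤ) ^ (j + 1)) • z)
      have hP : ((tower L N (j + 1 + 1) : ℕ) : ℤ) = (L : ℤ) * ((tower L N (j + 1) : ℕ) : ℤ) := natCast_tower_succ L N (j + 1)
      rw [hP] at hWP hYP
      have hW₁P : IsPeriodicCfg (cavg L W) ((tower L N (j + 1) : ℕ) : ℤ) := isPeriodicCfg_cavg L _ hWP
      have hQP : IsPeriodicDir (Qbar L W Y) ((tower L N (j + 1) : ℕ) : ℤ) := fun w i' κ => Qbar_add_period L hWP hYP w i' κ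
      rw [ih hW₁P hQP z i]
      congr 1
      -- the level-`j+1` frame read at `L^{j+1}•z`: period `L^{j+1}·N` divides the fine period `L·tower = L^{j+2}·N`… as `L * (L^{j+1} N)`
      have hP' : (L : ℤ) * ((tower L N (j + 1) : ℕ) : ℤ) = (L : ℤ) * ((L : ℤ) ^ (j + 1) * (N : ℤ)) := by
        rw [tower_eq_pow_mul]; push_cast; ring
      rw [hP'] at hWP hYP
      rw [smul_add, smul_smul, Fbar_add_period L hWP hYP]

/-! ## §4 The dressed lift, the covariant corrector, `R̂_W`; skewness, periodicity, flat reductions -/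

/-- **THE DRESSED SMOOTH LIFT** `A_W φ := (smoothLift M φ)^{u⁻¹}`, `M = L^{j+1}`, `u` the block comb gauge of `W` at scale `M`. [folklore] -/
def smoothLiftW (L j : ℕ) (W : Site d → Fin d → (Matrix n n ℂ)ˣ) (φ : Site d → Fin d → (Matrix n n ℂ)) : Site d → Fin d → (Matrix n n ℂ) :=
  dressDir (fun x => (combGauge (L ^ (j + 1)) W x)⁻¹) (smoothLift (L ^ (j + 1)) φ)

/-- THE FRAME GENERATOR IN THE COMB GAUGE: `Λ₀ := interp M univ (framePotW L (j+1) W₀ (smoothLift M φ))`. [folklore] -/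
def frameGenW (L j : ℕ) (W : Site d → Fin d → (Matrix n n ℂ)ˣ) (φ : Site d → Fin d → (Matrix n n ℂ)) : Site d → (Matrix n n ℂ) :=
  interp (L ^ (j + 1)) Finset.univ (framePotW L (j + 1) (combCfg (L ^ (j + 1)) W) (smoothLift (L ^ (j + 1)) φ))

/-- **THE COVARIANT CORRECTOR** `K_W φ := gaugeDir W (−Ad_{u⁻¹} Λ₀)` (a pure gauge direction at `W`). [folklore] -/
def correctorW (L j : ℕ) (W : Site d → Fin d → (Matrix n n ℂ)ˣ) (φ : Site d → Fin d → (Matrix n n ℂ)) : Site d → Fin d → (Matrix n n ℂ) :=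
  gaugeDir W (fun x => Ad (combGauge (L ^ (j + 1)) W x)⁻¹ (-frameGenW L j W φ x))

/-- **`R̂_W := A_W + K_W`** (exact on the frame part; the straight part is corrected in W5). [folklore] -/
def smoothRightInverseHatW (L j : ℕ) (W : Site d → Fin d → (Matrix n n ℂ)ˣ) (φ : Site d → Fin d → (Matrix n n ℂ)) : Site d → Fin d → (Matrix n n ℂ) :=
  fun x μ => smoothLiftW L j W φ x μ + correctorW L j W φ x μ

omit [Fintype n] [DecidableEq n] in
/-- The flat lift of a skew coarse field is skew. [folklore] -/
theorem isSkewDir_smoothLift (M : ℕ) {φ : Site d → Fin d → (Matrix n n ℂ)} (hφ : IsSkewDir φ) : IsSkewDir (smoothLift M φ) := fun x μ => by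
  unfold smoothLift
  exact skewAdjoint.smul_mem _ (hφ _ _)

/-- The dressed lift of a skew coarse field at a unitary background is skew. [folklore] -/
theorem isSkewDir_smoothLiftW (L j : ℕ) {W : Site d → Fin d → (Matrix n n ℂ)ˣ} (hWu : IsUnitaryCfg W) {φ : Site d → Fin d → (Matrix n n ℂ)} (hφ : IsSkewDir φ) :
    IsSkewDir (smoothLiftW L j W φ) :=
  isSkewDir_dressDir (combGauge_inv_mem hWu _) (isSkewDir_smoothLift _ hφ)

/-- The dressed lift of an `N`-periodic coarse field at an `(L^{j+1}·N)`-periodic background is `(L^{j+1}·N)`-periodic (`L ≥ 1`). [folklore] -/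
theorem isPeriodicDir_smoothLiftW {L : ℕ} (hL : 1 ≤ L) (j : ℕ) {N : ℕ} {W : Site d → Fin d → (Matrix n n ℂ)ˣ}
    (hWP : IsPeriodicCfg W (((L ^ (j + 1) : ℕ) : ℤ) * N)) {φ : Site d → Fin d → (Matrix n n ℂ)} (hφ : IsPeriodicDir φ (N : ℤ)) :
    IsPeriodicDir (smoothLiftW L j W φ) (((L ^ (j + 1) * N : ℕ) : ℤ)) := by
  have hM1 : 1 ≤ L ^ (j + 1) := Nat.one_le_pow _ _ hL
  intro x i μ
  have hP : ((L ^ (j + 1) * N : ℕ) : ℤ) = ((L ^ (j + 1) : ℕ) : ℤ) * N := by push_cast; ring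
  simp only [smoothLiftW, dressDir]
  rw [smoothLift_add_period hM1 (fun z τ κ => hφ z τ κ) x i μ, add_right_comm, hP, combGauge_add_period hM1 hWP]

/-- At `W = 1` the dressed lift is the flat lift. [folklore] -/
theorem smoothLiftW_flat (L j : ℕ) (φ : Site d → Fin d → (Matrix n n ℂ)) : smoothLiftW L j (flat (d := d) (n := n)) φ = smoothLift (L ^ (j + 1)) φ := by
  funext x μ
  simp only [smoothLiftW, dressDir, combGauge_flat, inv_one, Ad_one]

/-- At `W = 1` the frame generator is H3's interpolant of the FLAT accumulated frame potential (`L ≥ 1`). [folklore] -/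
theorem frameGenW_flat {L : ℕ} (hL : 1 ≤ L) (j : ℕ) (φ : Site d → Fin d → (Matrix n n ℂ)) :
    frameGenW L j (flat (d := d) (n := n)) φ = interp (L ^ (j + 1)) Finset.univ (framePot L (j + 1) (smoothLift (L ^ (j + 1)) φ)) := by
  simp only [frameGenW, combCfg_flat, framePotW_flat hL]

/-- **AT `W = 1`, `R̂_1 = smoothRightInverse L j`** (Π-R♭-3's exact flat right inverse). [folklore] -/
theorem smoothRightInverseHatW_flat {L : ℕ} (hL : 1 ≤ L) (j : ℕ) (φ : Site d → Fin d → (Matrix n n ℂ)) :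
    smoothRightInverseHatW L j (flat (d := d) (n := n)) φ = smoothRightInverse L j φ := by
  funext x μ
  simp only [smoothRightInverseHatW, smoothLiftW_flat, correctorW, frameGenW_flat hL, combGauge_flat, inv_one, Ad_one, gaugeDir_flat,
    smoothRightInverse, Pi.add_apply]
  simp only [dPot]
  abel

/-! ## §5 The exact identity: `D_W R̂_W` is the dressed straight average of the flat lift at `W₀` -/

/-- W1's covariance of `D_W` in `dressDir` form: `dirIter L (j+1) (W^u) (dressDir u ψ) = dressDir (u ∘ L^{j+1}•) (dirIter L (j+1) W ψ)`. [folklore] -/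
theorem dirIter_dressDir [Nonempty n] {L : ℕ} (hL : 1 ≤ L) (j : ℕ) {W : Site d → Fin d → (Matrix n n ℂ)ˣ} {x : ℝ} (hWu : IsUnitaryCfg W)
    (hx : 0 ≤ x) (hs : LevelSmall d L j x) (hWx : SmallField W x) {u : Site d → (Matrix n n ℂ)ˣ} (hu : ∀ y, u y ∈ unitaryUnits (Matrix n n ℂ))
    (ψ : Site d → Fin d → (Matrix n n ℂ)) :
    dirIter L (j + 1) (gaugeAct u W) (dressDir u ψ) = dressDir (fun w => u (((L : ℤ) ^ (j + 1)) • w)) (dirIter L (j + 1) W ψ) :=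
  dirIter_gaugeAct hL j hWu hx hs hWx hu ψ

/-- `gaugeDir W 0 = 0`. [folklore] -/
theorem gaugeDir_zero_fun (W : Site d → Fin d → (Matrix n n ℂ)ˣ) : gaugeDir W (fun _ => (0 : (Matrix n n ℂ))) = fun _ _ => 0 := by
  funext x μ; simp [gaugeDir, Ad_zero]

/-- **THE EXACT IDENTITY OF THE CURVED RIGHT INVERSE (frame part killed)**: for `L ≥ 2`, a unitary `(L^{j+1}·N)`-periodic `W` in the multi-level small-field
class (`LevelSmall d L j x`, `SmallField W x`) and a skew `N`-periodic coarse `φ`,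
`dirIter L (j+1) W (R̂_W φ) (z,κ) = Ad_{u(M(z+e_κ))⁻¹} (QbarIter L (j+1) W₀ (smoothLift M φ) (z,κ))`, `M = L^{j+1}`, `u = combGauge M W`, `W₀ = combCfg M W`.
[folklore] -/
theorem dirIter_smoothRightInverseHatW [Nonempty n] {L : ℕ} (hL : 2 ≤ L) (j : ℕ) {N : ℕ} [NeZero N] {W : Site d → Fin d → (Matrix n n ℂ)ˣ} {x : ℝ}
    (hWu : IsUnitaryCfg W) (hWP : IsPeriodicCfg W ((tower L N (j + 1) : ℕ) : ℤ)) (hx : 0 ≤ x) (hs : LevelSmall d L j x) (hWx : SmallField W x)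
    {φ : Site d → Fin d → (Matrix n n ℂ)} (hφ : IsSkewDir φ) (hφP : IsPeriodicDir φ (N : ℤ)) :
    dirIter L (j + 1) W (smoothRightInverseHatW L j W φ)
      = dressDir (fun z => (combGauge (L ^ (j + 1)) W (((L : ℤ) ^ (j + 1)) • z))⁻¹)
          (QbarIter L (j + 1) (combCfg (L ^ (j + 1)) W) (smoothLift (L ^ (j + 1)) φ)) := by
  have hL1 : 1 ≤ L := by omega
  have hM1 : 1 ≤ L ^ (j + 1) := Nat.one_le_pow _ _ hL1
  set M := L ^ (j + 1) with hMdef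
  set u : Site d → (Matrix n n ℂ)ˣ := combGauge M W with hudef
  set uinv : Site d → (Matrix n n ℂ)ˣ := fun y => (u y)⁻¹ with huinv
  set W₀ := combCfg M W with hW₀def
  set A := smoothLift M φ with hAdef
  set G := framePotW L (j + 1) W₀ A with hGdef
  set Λ₀ : Site d → (Matrix n n ℂ) := interp M Finset.univ G with hΛdef
  -- periods
  have hT : ((tower L N (j + 1) : ℕ) : ℤ) = ((M : ℕ) : ℤ) * N := by rw [tower_eq_pow_mul]; push_cast; rw [hMdef]; push_cast; ring
  have hWP' : IsPeriodicCfg W (((M : ℕ) : ℤ) * N) := by rw [← hT]; exact hWP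
  -- the comb-gauged background is in the same class
  have hu : ∀ y, u y ∈ unitaryUnits (Matrix n n ℂ) := combGauge_mem hWu M
  have huinvU : ∀ y, uinv y ∈ unitaryUnits (Matrix n n ℂ) := combGauge_inv_mem hWu M
  have hW₀u : IsUnitaryCfg W₀ := isUnitaryCfg_combCfg hWu M
  have hW₀x : SmallField W₀ x := smallField_combCfg hWu hWx M
  have hW₀P : IsPeriodicCfg W₀ ((tower L N (j + 1) : ℕ) : ℤ) := by rw [hT]; exact isPeriodicCfg_combCfg hM1 hWP'
  -- the flat lift: skew and periodic
  have hAs : IsSkewDir A := isSkewDir_smoothLift M hφ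
  have hAP : IsPeriodicDir A ((tower L N (j + 1) : ℕ) : ℤ) := by
    intro y i μ
    rw [hT, show ((M : ℕ) : ℤ) * (N : ℤ) = ((M * N : ℕ) : ℤ) by push_cast; ring]
    exact smoothLift_add_period hM1 (fun z τ κ => hφP z τ κ) y i μ
  -- the frame generator `Λ₀`: skew and periodic; its corner values are `G`
  have hGs : ∀ z, G z ∈ skewAdjoint (Matrix n n ℂ) := framePotW_skew hL1 j hW₀u hx hs hW₀x hAs
  have hGP : ∀ (z : Site d) (i : Fin d), G (z + (N : ℤ) • e i) = G z := framePotW_add_period L j hW₀P hAP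
  have hΛs : ∀ y, Λ₀ y ∈ skewAdjoint (Matrix n n ℂ) := fun y =>
    interp_mem (skewAdjoint (Matrix n n ℂ)) (fun r X hX => skewAdjoint.smul_mem r hX) M _ hGs y
  have hΛP : ∀ (y : Site d) (i : Fin d), Λ₀ (y + ((tower L N (j + 1) : ℕ) : ℤ) • e i) = Λ₀ y := by
    intro y i
    rw [hT, show ((M : ℕ) : ℤ) * (N : ℤ) = ((M * N : ℕ) : ℤ) by push_cast; ring]
    exact interp_add_period hM1 Finset.univ hGP y i
  have hnegΛs : ∀ y, (fun w => -Λ₀ w) y ∈ skewAdjoint (Matrix n n ℂ) := fun y => (skewAdjoint (Matrix n n ℂ)).neg_mem (hΛs y)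
  have hnegΛP : ∀ (y : Site d) (i : Fin d), (fun w => -Λ₀ w) (y + ((tower L N (j + 1) : ℕ) : ℤ) • e i) = (fun w => -Λ₀ w) y :=
    fun y i => by simp only [hΛP]
  have hcorner : ∀ z : Site d, Λ₀ (((L : ℤ) ^ (j + 1)) • z) = G z := fun z => by
    have h := interp_corner hM1 Finset.univ G z
    rwa [show (((M : ℕ) : ℤ)) = (L : ℤ) ^ (j + 1) by rw [hMdef]; push_cast; ring] at h
  -- (b) `R̂_W = (R̂₀)^{u⁻¹}` with `R̂₀ = A + gaugeDir W₀ (−Λ₀)`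
  have hWeq : gaugeAct uinv W₀ = W := gaugeAct_inv_gaugeAct u W
  have hR : smoothRightInverseHatW L j W φ
      = dressDir uinv (fun y μ => A y μ + gaugeDir W₀ (fun w => -Λ₀ w) y μ) := by
    rw [dressDir_add]
    funext y μ
    simp only [smoothRightInverseHatW]
    congr 1
    -- the corrector: `gaugeDir W (Ad_{u⁻¹}(−Λ₀)) = (gaugeDir W₀ (−Λ₀))^{u⁻¹}` by W1's `gaugeDir_gaugeAct` at `W = (W₀)^{u⁻¹}`
    have h := gaugeDir_gaugeAct uinv W₀ (fun w => -Λ₀ w)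
    rw [hWeq] at h
    show gaugeDir W (fun w => Ad (combGauge (L ^ (j + 1)) W w)⁻¹ (-frameGenW L j W φ w)) y μ = _
    have hfg : (fun w => Ad (combGauge (L ^ (j + 1)) W w)⁻¹ (-frameGenW L j W φ w)) = fun w => Ad (uinv w) ((fun w => -Λ₀ w) w) := rfl
    rw [hfg, h]
    rfl
  -- (c) move to `W₀` by W1, (d) kill the frame part there
  rw [hR, ← hWeq, dirIter_dressDir (by omega) j hW₀u hx hs hW₀x huinvU]
  have hD : dirIter L (j + 1) W₀ (fun y μ => A y μ + gaugeDir W₀ (fun w => -Λ₀ w) y μ) = QbarIter L (j + 1) W₀ A := by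
    rw [dirIter_add (by omega) j hW₀u hx hs hW₀x, dirIter_eq_QbarIter_add_gaugeDir (M := N) (by omega) j hW₀u hW₀P hx hs hW₀x hAs hAP,
      dirIter_gaugeDir (M := N) (by omega) j hW₀u hW₀P hx hs hW₀x hnegΛs hnegΛP]
    funext z κ
    rw [add_assoc, ← gaugeDir_add_fun]
    have h0 : (fun w => G w + -Λ₀ (((L : ℤ) ^ (j + 1)) • w)) = fun _ => (0 : (Matrix n n ℂ)) := by
      funext w; rw [hcorner, add_neg_cancel]
    rw [h0, gaugeDir_zero_fun, add_zero]
  rw [hD]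

/-- **… AND THE DRESSING AT THE COARSE SITES IS TRIVIAL** (the comb gauge is `1` at block corners), so
`dirIter L (j+1) W (R̂_W φ) = QbarIter L (j+1) W₀ (smoothLift M φ)` EXACTLY: the curved right inverse is exact up to the straight part at the comb-gauged
background — the input of W4∕W5. [folklore] -/
theorem dirIter_smoothRightInverseHatW_eq [Nonempty n] {L : ℕ} (hL : 2 ≤ L) (j : ℕ) {N : ℕ} [NeZero N] {W : Site d → Fin d → (Matrix n n ℂ)ˣ} {x : ℝ}
    (hWu : IsUnitaryCfg W) (hWP : IsPeriodicCfg W ((tower L N (j + 1) : ℕ) : ℤ)) (hx : 0 ≤ x) (hs : LevelSmall d L j x) (hWx : SmallField W x)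
    {φ : Site d → Fin d → (Matrix n n ℂ)} (hφ : IsSkewDir φ) (hφP : IsPeriodicDir φ (N : ℤ)) :
    dirIter L (j + 1) W (smoothRightInverseHatW L j W φ) = QbarIter L (j + 1) (combCfg (L ^ (j + 1)) W) (smoothLift (L ^ (j + 1)) φ) := by
  have hM1 : 1 ≤ L ^ (j + 1) := Nat.one_le_pow _ _ (by omega)
  rw [dirIter_smoothRightInverseHatW hL j hWu hWP hx hs hWx hφ hφP]
  funext z κ
  simp only [dressDir]
  rw [show ((L : ℤ) ^ (j + 1)) • (z + e κ) = (((L ^ (j + 1) : ℕ) : ℤ)) • (z + e κ) by push_cast; ring_nf, combGauge_corner hM1,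
    inv_one, Ad_one]

end

end Summit.QuantumFields.BalabanUV.T4Continuum.NE3SmoothLiftW
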